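import Summits.CriticalPhenomena.Ising3DConformalLimit.Theorems.FKParityRobustnessDepletionBound
import Literature.Probability.LatticeModels.ModifiedSimonInequality
import Literature.Probability.LatticeModels.LoopO1
import HarnessLib

/-!
# Crux `StrandShadow` (stmt-CriticalPhenomena-14626), line `loop-footprint-strand-mass` —
# stub `stub_clusterLoopFibre`

Route `FKParityRobustness`, sub-problem `Ising3DConformalLimit`.  The source-cluster / loop-soup
fibre decomposition of the sourced loop-O(1) sums on a finite graph `G`, at edge weight `t`, with
sources `{x, y}`.  Write `x ↝_F v` for reachability in `fromEdgeSet F`,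
`K_x(F) = {f ∈ F : some endpoint of f is F-reachable from x}` for the `x`-cluster of `F`,
`Λ_K = {v : ¬ x ↝_K v}` for the depleted volume of `K`, `ℰ_Λ = edgesIn G Λ`, and let the CLUSTER
INDEX SET be the self-clustered `K ⊆ E(G)` (`K_x(K) = K`) with odd-degree set `{x, y}`.  Every
`T`-join `F ∈ 𝒯_{xy}(G)` (`tJoins G univ {x,y}`) is `K ⊔ R` with `K = K_x(F)` in the index set and
`R` an even subgraph of `ℰ_{Λ_K}` (`DepletionBound.sum_avoid_eq_sum_fibres`, `DepletionBound.fibre_sum`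
of `Theorems/FKParityRobustnessDepletionBound(Clusters).lean`).  The stub is the conjunction of

* (i) the `t^{|F|}`-mass of the `T`-joins containing a fixed edge `e` as a LOOP edge (i.e. `e ∈ F`
  but not every endpoint of `e` is joined to `x` in `F`) equals
  `Σ_K t^{|K|} · Σ_{R ⊆ ℰ_{Λ_K} even, e ∈ R} t^{|R|}`;
* (ii) `Z^{xy}_t(G) = Σ_K t^{|K|} · g_{Λ_K}(∅)` with `g_Λ(A) = hteSum G Λ t A`.

**Proof.** (ii) is `DepletionBound.hteSum_sdiff_pair_eq` at `S = ∅` together with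
`Z^{xy}_t = g_{univ}({x,y})` (`DepletionBound.loopO1PartitionFunction_eq_hteSum`).  For (i), apply
the outer decomposition at `S = ∅` to `g(F) = t^{|F|} · 1[e is a loop edge of F]` and the fibre
bijection `F ↦ F ∖ K`, `R ↦ K ∪ R` with terminal set `T = ∅`; fibrewise, for `R ⊆ ℰ_{Λ_K}` the edge
`e` is a loop edge of `K ∪ R` iff `e ∈ R` (`loopEdge_union_iff`: edges of `K` have all endpoints
`x`-reachable already in `K`, edges of `R` have all endpoints in `Λ_K`, and `(K ∪ R)`-reachability
from `x` is `K`-reachability, `DepletionBound.rch_union_iff`), and `|K ∪ R| = |K| + |R|`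
(`DepletionBound.disjoint_of_avoid`).
-/

noncomputable section

open Finset SimpleGraph
open Literature.Probability.LatticeModels

namespace Summit.CriticalPhenomena.Ising3DConformalLimit.Theorems.StrandShadowFootprint

open scoped Classical symmDiff

/-- **Loop edges in a fibre.** For a self-clustered `K` at `x` and an edge set `R` none of whose
endpoints is `K`-reachable from `x`, an edge of `K ∪ R` not all of whose endpoints are
`(K ∪ R)`-reachable from `x` is exactly an edge of `R`. -/
theorem loopEdge_union_iff {V : Type*} [Fintype V] [DecidableEq V] {K R : Finset (Sym2 V)} {x : V}
    (hK : (Finset.filter (fun f => ∃ v ∈ f,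
      (SimpleGraph.fromEdgeSet ((K : Finset (Sym2 V)) : Set (Sym2 V))).Reachable x v) K) = K)
    (hR : ∀ f ∈ R, ∀ v ∈ f,
      ¬ (SimpleGraph.fromEdgeSet ((K : Finset (Sym2 V)) : Set (Sym2 V))).Reachable x v)
    (e : Sym2 V) :
    (e ∈ K ∪ R ∧ ¬ ∀ w ∈ e,
        (SimpleGraph.fromEdgeSet ((K ∪ R : Finset (Sym2 V)) : Set (Sym2 V))).Reachable x w) ↔
      e ∈ R := by
  constructor
  · rintro ⟨heKR, hnot⟩
    rcases Finset.mem_union.1 heKR with heK | heR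
    · exact absurd (fun w hw => DepletionBound.rch_mono Finset.subset_union_left
        (DepletionBound.rch_of_mem_of_self hK heK hw)) hnot
    · exact heR
  · intro heR
    refine ⟨Finset.mem_union_right _ heR, fun hall => ?_⟩
    have hw := hall _ (Sym2.out_fst_mem e)
    rw [DepletionBound.rch_union_iff hR] at hw
    exact hR e heR _ (Sym2.out_fst_mem e) hw

/-- **Stub `stub_clusterLoopFibre`** of the line `loop-footprint-strand-mass` (crux `StrandShadow`,
stmt-CriticalPhenomena-14626): the source-cluster / loop-soup fibre decomposition of the sourced
loop-O(1) sums.  Over the cluster index set (self-clustered `K ⊆ E(G)` at `x` with `∂K = {x, y}`):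
(i) the `t^{|F|}`-mass of the `T`-joins `F ∈ 𝒯_{xy}(G)` containing `e` as a loop edge (`e ∈ F`, not
every endpoint of `e` joined to `x` in `F`) is `Σ_K t^{|K|} · Σ_{R ⊆ ℰ_{Λ_K} even, e ∈ R} t^{|R|}`;
(ii) `Z^{xy}_t(G) = Σ_K t^{|K|} · g_{Λ_K}(∅)`. -/
theorem stub_clusterLoopFibre :
    ∀ (V : Type) [Fintype V] [DecidableEq V] (G : SimpleGraph V) [DecidableRel G.Adj] (t : ℝ)
      (x y : V) (e : Sym2 V),
      (∑ F ∈ (tJoins G Set.univ {x, y}).filter (fun F : Finset (Sym2 V) =>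
            e ∈ F ∧ ¬ ∀ w ∈ e, (SimpleGraph.fromEdgeSet (↑F : Set (Sym2 V))).Reachable x w),
          t ^ F.card)
        = ∑ K ∈ (G.edgeFinset.powerset.filter fun K : Finset (Sym2 V) =>
              (K.filter fun f : Sym2 V =>
                  ∃ v ∈ f, (SimpleGraph.fromEdgeSet (↑K : Set (Sym2 V))).Reachable x v) = K ∧
              (∀ v : V, Odd (K.filter fun f : Sym2 V => v ∈ f).card ↔ v ∈ ({x, y} : Finset V))),
            t ^ K.card *
              ∑ R ∈ ((edgesIn G (Finset.univ.filter fun v : V => ¬ (SimpleGraph.fromEdgeSet (↑K : Set (Sym2 V))).Reachable x v)).powerset.filter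
                  fun R : Finset (Sym2 V) =>
                    oddVerts (Finset.univ.filter fun v : V => ¬ (SimpleGraph.fromEdgeSet (↑K : Set (Sym2 V))).Reachable x v) R = ∅).filter
                (fun R : Finset (Sym2 V) => e ∈ R), t ^ R.card ∧
      loopO1PartitionFunction G t {x, y}
        = ∑ K ∈ (G.edgeFinset.powerset.filter fun K : Finset (Sym2 V) =>
              (K.filter fun f : Sym2 V =>
                  ∃ v ∈ f, (SimpleGraph.fromEdgeSet (↑K : Set (Sym2 V))).Reachable x v) = K ∧
              (∀ v : V, Odd (K.filter fun f : Sym2 V => v ∈ f).card ↔ v ∈ ({x, y} : Finset V))),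
            t ^ K.card *
              hteSum G (Finset.univ.filter fun v : V => ¬ (SimpleGraph.fromEdgeSet (↑K : Set (Sym2 V))).Reachable x v) t ∅ := by
  intro V _ _ G _ t x y e
  refine ⟨?_, ?_⟩
  · -- (i): outer decomposition at `S = ∅` applied to `t^{|F|} · 1[e is a loop edge of F]`
    have h1 := DepletionBound.sum_avoid_eq_sum_fibres G x y ∅ (fun F : Finset (Sym2 V) =>
      if e ∈ F ∧ ¬ ∀ w ∈ e, (SimpleGraph.fromEdgeSet (↑F : Set (Sym2 V))).Reachable x w
        then t ^ F.card else 0)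
    simp only [Finset.notMem_empty, false_imp_iff, imp_true_iff, Finset.filter_true,
      and_true] at h1
    rw [Finset.sum_filter (fun F : Finset (Sym2 V) =>
      e ∈ F ∧ ¬ ∀ w ∈ e, (SimpleGraph.fromEdgeSet (↑F : Set (Sym2 V))).Reachable x w), h1]
    refine Finset.sum_congr rfl fun K hK => ?_
    rw [Finset.mem_filter, Finset.mem_powerset] at hK
    obtain ⟨hKG, hKself, hKodd⟩ := hK
    -- the fibre bijection `F ↦ F \ K`, `R ↦ K ∪ R` with terminal set `T = ∅`
    have hfib := DepletionBound.fibre_sum G hKG hKself hKodd (T := ∅) (Finset.empty_subset _)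
      (fun F : Finset (Sym2 V) =>
        if e ∈ F ∧ ¬ ∀ w ∈ e, (SimpleGraph.fromEdgeSet (↑F : Set (Sym2 V))).Reachable x w
          then t ^ F.card else 0)
    rw [Finset.union_empty] at hfib
    rw [hfib, Finset.sum_filter (fun R : Finset (Sym2 V) => e ∈ R), Finset.mul_sum]
    refine Finset.sum_congr rfl fun R hR => ?_
    rw [Finset.mem_filter, Finset.mem_powerset] at hR
    have havoid : ∀ f ∈ R, ∀ v ∈ f,
        ¬ (SimpleGraph.fromEdgeSet (↑K : Set (Sym2 V))).Reachable x v := fun f hf v hv =>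
      DepletionBound.mem_dVol.1 ((mem_edgesIn_iff.1 (hR.1 hf)).2 v hv)
    -- fibrewise: `e` is a loop edge of `K ∪ R` iff `e ∈ R`, and `|K ∪ R| = |K| + |R|`
    by_cases heR : e ∈ R
    · rw [if_pos ((loopEdge_union_iff hKself havoid e).2 heR), if_pos heR,
        Finset.card_union_of_disjoint (DepletionBound.disjoint_of_avoid hKself havoid), pow_add]
    · rw [if_neg (fun h => heR ((loopEdge_union_iff hKself havoid e).1 h)), if_neg heR, mul_zero]
  · -- (ii): `Z^{xy} = g_{univ}({x,y})`, fibred over the cluster index set at `S = ∅`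
    have h2 := DepletionBound.hteSum_sdiff_pair_eq G x y ∅ t
    simp only [Finset.sdiff_empty, Finset.notMem_empty, false_imp_iff, imp_true_iff,
      and_true] at h2
    rw [DepletionBound.loopO1PartitionFunction_eq_hteSum]
    exact h2

end Summit.CriticalPhenomena.Ising3DConformalLimit.Theorems.StrandShadowFootprint

end
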